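/-
Copyright (c) 2026 the pub-hodgecm-mathlib formalisation cell (harness21).  Typer seat hodgecm-mathlib-TM-t06 (g0) as TS co-typer (R14).
-/
import Literature.AlgebraicGeometry.ModuliOfAbelianVarieties.Lan2013.AppA1toA3EtaleTopology
import HarnessLib

/-!
# Lan (2013), App. A, Lemma A.2.6 — discharge of the named fact `Lan2013_A26_quasiSeparated` of ★`AppA1toA3EtaleTopology`
# (HOLDS proof file: theorems only, no new statement)

`Lan2013_A26_quasiSeparated` («`S` separated noetherian, `U → S` locally of finite type ⟹ `U` quasi-separated», [cite: Lan2013PELCompactifications,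
Lem. A.2.6 (p. 493)], Lan's proof: [69, I, 2.26]) holds in Mathlib by the road named in its docstring: a scheme locally of finite type over a
locally noetherian scheme is locally noetherian (`AlgebraicGeometry.LocallyOfFiniteType.isLocallyNoetherian`), and a locally noetherian scheme
has quasi-separated underlying space (`AlgebraicGeometry.IsLocallyNoetherian.quasiSeparatedSpace`, [stacks 01OY]); separatedness of `S` is
not used (the printed hypothesis is stronger than needed).  Requested by T-ref7 «QA7-16» (γ-rule).  Net debt −1.

ED. 2 (append protocol): `Lan2013_A34_stableMorphismProperties_holds` and `Lan2013_A36_localOnSourceProperties_holds` — Prop. A.3.4 ∕ A.3.6 as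
typed (Def. A.3.3 ∕ A.3.5 read literally: «⇒» = preservation under étale-surjective base change (+ étale-surjective precomposition), «⇐» via
`g = 𝟙`, see ED. 2 of the carpet) hold in Mathlib: every listed class is `MorphismProperty.IsStableUnderBaseChange` and `RespectsIso`, is stable
under composition, and `Etale` implies `Flat`, `UniversallyOpen`, `LocallyOfFinitePresentation`, `LocallyOfFiniteType` (instances).  Elementary
combinators (`morStableInEtaleTopology_of`, `…_and`, `morStableLocalOnSource_of`, `…_and`) keep the conjunction-valued properties
(`finiteType`, `finitePresentation`, `universallyBijective`, `quasiFinite`, `faithfullyFlat`) free of lattice bookkeeping.  Net debt −2.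
-/

open CategoryTheory CategoryTheory.Limits AlgebraicGeometry

universe u

namespace Literature.AlgebraicGeometry.ModuliOfAbelianVarieties.Lan2013.AppA1toA3EtaleTopology

/-- **Lemma A.2.6 holds** (discharge of `Lan2013_A26_quasiSeparated`): locally of finite type over a noetherian base ⟹ locally noetherian ⟹
quasi-separated. [cite: Lan2013PELCompactifications, Lem. A.2.6 (p. 493)] -/
theorem Lan2013_A26_quasiSeparated_holds : Lan2013_A26_quasiSeparated := by
  intro S U f _ hS hf
  have : IsLocallyNoetherian U := LocallyOfFiniteType.isLocallyNoetherian f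
  infer_instance

/-! ## ED. 2 — Prop. A.3.4 and Prop. A.3.6 hold (as typed) -/

/-- Combinator: a property preserved by arbitrary base change and invariant under precomposition with isomorphisms satisfies Def. A.3.3's
sentence (`MorStableInEtaleTopology`). [folklore] -/
private theorem morStableInEtaleTopology_of (P : MorphismProperty Scheme.{u})
    (hbc : ∀ ⦃X Y U : Scheme.{u}⦄ (f : X ⟶ Y) (g : U ⟶ Y), P f → P (pullback.snd f g))
    (hiso : ∀ ⦃X X' Y : Scheme.{u}⦄ (e : X' ⟶ X) (f : X ⟶ Y), IsIso e → P (e ≫ f) → P f) :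
    MorStableInEtaleTopology P := by
  intro X Y f
  refine ⟨fun hf U g _ _ => hbc f g hf, fun H => ?_⟩
  have h := H Y (𝟙 Y) inferInstance inferInstance
  have e : pullback.fst f (𝟙 Y) ≫ f = pullback.snd f (𝟙 Y) := by
    have c := pullback.condition (f := f) (g := 𝟙 Y)
    rwa [Category.comp_id] at c
  rw [← e] at h
  exact hiso _ f inferInstance h

/-- Combinator: Mathlib's `IsStableUnderBaseChange` + `RespectsIso` suffice. [folklore] -/
private theorem morStableInEtaleTopology_of_isStableUnderBaseChange (P : MorphismProperty Scheme.{u})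
    [P.IsStableUnderBaseChange] [P.RespectsIso] : MorStableInEtaleTopology P :=
  morStableInEtaleTopology_of P (fun _ _ _ f g hf => P.pullback_snd f g hf)
    (fun _ _ _ e f _ h => (P.cancel_left_of_respectsIso e f).mp h)

/-- Combinator: conjunctions. [folklore] -/
private theorem morStableInEtaleTopology_and (P Q : MorphismProperty Scheme.{u})
    (hP : MorStableInEtaleTopology P) (hQ : MorStableInEtaleTopology Q) :
    MorStableInEtaleTopology (fun _ _ f => P f ∧ Q f) := by
  intro X Y f
  refine ⟨fun hf U g hg hs => ⟨(hP f).1 hf.1 U g hg hs, (hQ f).1 hf.2 U g hg hs⟩, fun H => ⟨?_, ?_⟩⟩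
  · exact (hP f).2 fun U g hg hs => (H U g hg hs).1
  · exact (hQ f).2 fun U g hg hs => (H U g hg hs).2

/-- **Proposition A.3.4 holds** (as typed): discharge of `Lan2013_A34_stableMorphismProperties`.
[cite: Lan2013PELCompactifications, Prop. A.3.4 (p. 493)] -/
theorem Lan2013_A34_stableMorphismProperties_holds : Lan2013_A34_stableMorphismProperties.{u} := by
  refine ⟨?_, ?_, ?_, ?_, ?_, ?_, ?_, ?_, ?_, ?_, ?_⟩
  · exact morStableInEtaleTopology_of_isStableUnderBaseChange @QuasiCompact
  · exact morStableInEtaleTopology_of_isStableUnderBaseChange @IsSeparated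
  · exact morStableInEtaleTopology_of_isStableUnderBaseChange @UniversallyInjective
  · exact morStableInEtaleTopology_of_isStableUnderBaseChange @UniversallyClosed
  · exact morStableInEtaleTopology_and _ _
      (morStableInEtaleTopology_of_isStableUnderBaseChange @LocallyOfFiniteType)
      (morStableInEtaleTopology_of_isStableUnderBaseChange @QuasiCompact)
  · exact morStableInEtaleTopology_and _ _
      (morStableInEtaleTopology_of_isStableUnderBaseChange @LocallyOfFinitePresentation)
      (morStableInEtaleTopology_and _ _
        (morStableInEtaleTopology_of_isStableUnderBaseChange @QuasiCompact)
        (morStableInEtaleTopology_of_isStableUnderBaseChange @QuasiSeparated))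
  · exact morStableInEtaleTopology_of_isStableUnderBaseChange @IsFinite
  · exact morStableInEtaleTopology_and _ _
      (morStableInEtaleTopology_of_isStableUnderBaseChange @UniversallyInjective)
      (morStableInEtaleTopology_of_isStableUnderBaseChange @Surjective)
  · exact morStableInEtaleTopology_and _ _
      (morStableInEtaleTopology_of_isStableUnderBaseChange @LocallyQuasiFinite)
      (morStableInEtaleTopology_of_isStableUnderBaseChange @QuasiCompact)
  · exact morStableInEtaleTopology_of_isStableUnderBaseChange (MorphismProperty.isomorphisms Scheme.{u})
  · exact morStableInEtaleTopology_of_isStableUnderBaseChange @QuasiSeparated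

/-- Combinator: a property preserved by base change and by precomposition with étale surjections, and invariant under precomposition with
isomorphisms, satisfies Def. A.3.5's sentence (`MorStableLocalOnSource`). [folklore] -/
private theorem morStableLocalOnSource_of (P : MorphismProperty Scheme.{u})
    (hbc : ∀ ⦃X Y U : Scheme.{u}⦄ (f : X ⟶ Y) (g : U ⟶ Y), P f → P (pullback.snd f g))
    (hcomp : ∀ ⦃V X Y : Scheme.{u}⦄ (h : V ⟶ X) (f : X ⟶ Y), Etale h → Surjective h → P f → P (h ≫ f))
    (hiso : ∀ ⦃X X' Y : Scheme.{u}⦄ (e : X' ⟶ X) (f : X ⟶ Y), IsIso e → P (e ≫ f) → P f) :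
    MorStableLocalOnSource P := by
  intro X Y f
  refine ⟨fun hf U g _ _ V h hh hs => hcomp h _ hh hs (hbc f g hf), fun H => ?_⟩
  have h := H Y (𝟙 Y) inferInstance inferInstance (pullback f (𝟙 Y)) (𝟙 _) inferInstance inferInstance
  rw [Category.id_comp] at h
  have e : pullback.fst f (𝟙 Y) ≫ f = pullback.snd f (𝟙 Y) := by
    have c := pullback.condition (f := f) (g := 𝟙 Y)
    rwa [Category.comp_id] at c
  rw [← e] at h
  exact hiso _ f inferInstance h

/-- Combinator: conjunctions (Def. A.3.5 form). [folklore] -/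
private theorem morStableLocalOnSource_and (P Q : MorphismProperty Scheme.{u})
    (hP : MorStableLocalOnSource P) (hQ : MorStableLocalOnSource Q) :
    MorStableLocalOnSource (fun _ _ f => P f ∧ Q f) := by
  intro X Y f
  refine ⟨fun hf U g hg hs V h hh hhs => ⟨(hP f).1 hf.1 U g hg hs V h hh hhs, (hQ f).1 hf.2 U g hg hs V h hh hhs⟩,
    fun H => ⟨?_, ?_⟩⟩
  · exact (hP f).2 fun U g hg hs V h hh hhs => (H U g hg hs V h hh hhs).1
  · exact (hQ f).2 fun U g hg hs V h hh hhs => (H U g hg hs V h hh hhs).2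

/-- Combinator: a Mathlib class stable under base change and composition, respecting isomorphisms and implied by `Etale`, satisfies Def. A.3.5. [folklore] -/
private theorem morStableLocalOnSource_of_class (P : MorphismProperty Scheme.{u})
    [P.IsStableUnderBaseChange] [P.RespectsIso] [P.IsStableUnderComposition]
    (hEt : ∀ ⦃V X : Scheme.{u}⦄ (h : V ⟶ X), Etale h → Surjective h → P h) : MorStableLocalOnSource P :=
  morStableLocalOnSource_of P (fun _ _ _ f g hf => P.pullback_snd f g hf)
    (fun _ _ _ h f hh hs hf => P.comp_mem h f (hEt h hh hs) hf)
    (fun _ _ _ e f _ h => (P.cancel_left_of_respectsIso e f).mp h)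

/-- **Proposition A.3.6 holds** (as typed): discharge of `Lan2013_A36_localOnSourceProperties`.
[cite: Lan2013PELCompactifications, Prop. A.3.6 (p. 493)] -/
theorem Lan2013_A36_localOnSourceProperties_holds : Lan2013_A36_localOnSourceProperties.{u} := by
  have hS : MorStableLocalOnSource.{u} @Surjective :=
    morStableLocalOnSource_of_class @Surjective fun _ _ h _ hs => hs
  have hF : MorStableLocalOnSource.{u} @Flat :=
    morStableLocalOnSource_of_class @Flat fun _ _ h hh _ => inferInstance
  refine ⟨hS, hF, morStableLocalOnSource_and _ _ hF hS, ?_, ?_, ?_, ?_⟩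
  · exact morStableLocalOnSource_of_class @UniversallyOpen fun _ _ h hh _ => inferInstance
  · exact morStableLocalOnSource_of_class @Etale fun _ _ h hh _ => hh
  · exact morStableLocalOnSource_of_class @LocallyOfFinitePresentation fun _ _ h hh _ => inferInstance
  · exact morStableLocalOnSource_of_class @LocallyOfFiniteType fun _ _ h hh _ => inferInstance

end Literature.AlgebraicGeometry.ModuliOfAbelianVarieties.Lan2013.AppA1toA3EtaleTopology
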